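import Summits.ValiantsHypothesis.ValiantsHypothesis.Theorems.KPlusLogSqLawTropicalBStaticPorts

/-!
# Route «KPlusLogSqLaw», crux `TropicalB` (stmt-ValiantsHypothesis-19771) — the attack foothold `stub_tropTowerLog` IN STATIC DRESS:
# it is a statement about plain parametric ASSIGNMENT (one slope class per entry) at `K`-fold size

HONEST FRAMING.  Helper toward the registered attack-foothold stub `stub_tropTowerLog` of `Cruxes/TropicalB/Lines/birth.lean`
(`∃ C, ∀ K, TropRow (K·⌊log₂ K⌋) K (2^(C·K))`, `TropRow = TropicalCensus.TropRootLawAt` by `Iff.rfl`; crux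
`Summit.ValiantsHypothesis.ValiantsHypothesis.Theses.KPlusLogSqLaw.TropicalB`, item stmt-ValiantsHypothesis-19771, route KPlusLogSqLaw;
hand leafhand-val-kpluslogsqlaw-1 g17, 2026-09-01; `--supports … --as helper`).  Three IMPLICATIONS between OPEN statements, by composing
the tree's static port embedding `TropicalCensus.tropRootLawAt_of_static_ports` (`TropRootLawAtStatic (m·K) K B → TropRootLawAt m K B`,
val-sym-trop-p4) and the restriction `tropRootLawAtStatic_of_tropRootLawAt`.  Nothing here proves or refutes the foothold, and nothing bears on
`TropicalB` in its window, `WeakLifting`, `Lifting`, `MatrixDescartes` (stmt-ValiantsHypothesis-18050) or VP ≠ VNP.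

* `TowerLogStatic.towerLog_of_static` — the foothold FOLLOWS from its static version at size `K·⌊log₂ K⌋·K` (same class count, same budget);
* `TowerLogStatic.static_of_towerLog` — and IMPLIES its static version at its own size (restriction);
* `TowerLogStatic.exists_static_family_of_not_towerLog` — contrapositive of the first: a failure of the foothold is witnessed by STATIC designs,
  i.e. by instances `A + θ·B` of the parametric assignment problem on `n = K²·⌊log₂ K⌋` nodes whose slope matrix `B` takes `K` values, with
  more than `2^(C·K)` sign-alternating breakpoints, for every `C`.

READING (docstring only, nothing asserted).  Since `2^(C·K) ≥ 2^(C·√(n / log₂ n))` at `n = K²·⌊log₂ K⌋`, refuting the foothold would lift the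
standing lower bound `β(DS_n) ≥ 2^(Ω(log² n))` for the parametric assignment problem / the shadow complexity of the Birkhoff polytope
[Carstensen 1983; Mulmuley–Shah 2001; Hrubeš–Yehudayoff, *Shadows of Newton polytopes*, CCC 2021, Prop. 23 and Open Problem 1] to a
stretched-exponential one; proving it needs a bound below both entropy counting (`tropRootLawAt_entropy`) and halving (`tropRowD_four_pow`,
= Prop. 23's upper side).  [folklore: composition of tree lemmas; the reading is the hand's memo evidence-g17-reading.md on stmt-19771]
-/

set_option linter.dupNamespace false
set_option autoImplicit false

namespace Summit.ValiantsHypothesis.ValiantsHypothesis.Theorems.KPlusLogSqLaw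

open Summit.ValiantsHypothesis.ValiantsHypothesis.Theorems.LacunarySymmetroidMatrixDescartes.TropicalCensus

namespace TowerLogStatic

/-- **The foothold follows from its static version at `K`-fold size**: if every STATIC design of format `(K·⌊log₂ K⌋·K, K)` obeys the
budget `2^(C·K)`, then every design of format `(K·⌊log₂ K⌋, K)` does (static port embedding, no loss in the bound). [folklore] -/
theorem towerLog_of_static
    (h : ∃ C : ℕ, ∀ K : ℕ, TropRootLawAtStatic (K * Nat.log 2 K * K) K (2 ^ (C * K))) :
    ∃ C : ℕ, ∀ K : ℕ, TropRootLawAt (K * Nat.log 2 K) K (2 ^ (C * K)) := by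
  obtain ⟨C, hC⟩ := h
  exact ⟨C, fun K => tropRootLawAt_of_static_ports (K * Nat.log 2 K) K _ (hC K)⟩

/-- **The foothold implies its static version at its own size** (a static design is a design). [folklore] -/
theorem static_of_towerLog
    (h : ∃ C : ℕ, ∀ K : ℕ, TropRootLawAt (K * Nat.log 2 K) K (2 ^ (C * K))) :
    ∃ C : ℕ, ∀ K : ℕ, TropRootLawAtStatic (K * Nat.log 2 K) K (2 ^ (C * K)) := by
  obtain ⟨C, hC⟩ := h
  exact ⟨C, fun K => tropRootLawAtStatic_of_tropRootLawAt (hC K)⟩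

/-- **A failure of the foothold is witnessed by plain parametric assignment instances**: if the foothold fails, then for every
budget constant `C` some STATIC design of format `(K·⌊log₂ K⌋·K, K)` — an instance of the `K`-slope parametric assignment problem on
`K²·⌊log₂ K⌋` nodes — has more than `2^(C·K)` sign-alternating dominant terms. [folklore] -/
theorem exists_static_family_of_not_towerLog
    (h : ¬ ∃ C : ℕ, ∀ K : ℕ, TropRootLawAt (K * Nat.log 2 K) K (2 ^ (C * K))) :
    ∀ C : ℕ, ∃ K : ℕ, ¬ TropRootLawAtStatic (K * Nat.log 2 K * K) K (2 ^ (C * K)) := by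
  intro C
  by_contra hcon
  push Not at hcon
  exact h (towerLog_of_static ⟨C, hcon⟩)

end TowerLogStatic

end Summit.ValiantsHypothesis.ValiantsHypothesis.Theorems.KPlusLogSqLaw
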